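import Mathlib.Analysis.SpecialFunctions.Log.Base
import Literature.Computability.Complexity.MonotoneMatchingDepth
import Literature.Computability.Complexity.FormulaComposition
import Literature.Computability.Complexity.CircuitRestriction
import Literature.Computability.Complexity.CircuitLP
import Literature.Computability.Complexity.KWProtocolFormula
import HarnessLib

/-!
# The Formula Balancing Lemma for monotone formulas (Spira) — discharge of
# `monotoneFormula_balancing`

`Literature.Computability.Complexity.monotoneFormula_balancing` (file `MonotoneMatchingDepth`)
is the named fact: there is an absolute constant `c > 0` such that every monotone straight-line
formula `F` (a `{∧₂, ∨₂}`-circuit of the tree's model `Circuit ι` in which every gate is read at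
most once) is equivalent to a monotone formula of depth at most `c · log₂ (F.size + 1)`
(Spira 1971; Jukna 2012, Lemma 6.1 and §6.1). This file PROVES it, with `c = 6`
(`monotoneFormula_balancing_holds`), following the classical argument described by Jukna
(book p. 160: "choose a particular subformula, balance it, then balance the rest of the formula,
and finally combine these balanced formulas"), in Spira's `2/3` form:

1. `AndOrTree ι` — binary `∧/∨` trees with variable leaves and constant leaves; `eval`, `leaves`
   (constants do not count), `depth`.
2. Unfolding (`GateList.trees`): the gates of a well-formed straight-line program over
   `monotoneBasis` unfold into constant-free trees with the same values
   (`GateList.trees_spec`); for a FORMULA the tree of an unreferenced gate has at most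
   `#gates + 1` leaves — the fan-out-`1` potential `Σ_{m unreferenced} (leaves m − 1) ≤ #gates`
   (`GateList.leaves_potential`), whence `Circuit.exists_tree_of_formula`.
3. Spira's split (`AndOrTree.cut`): descending from the root into the heavier subtree until at most
   `k = ⌊2m/3⌋` of the `m` leaves remain gives a subtree `G` with `m/3 < leaves G ≤ 2m/3` and,
   by monotonicity, `F ≡ (G ∧ F[G ← 1]) ∨ F[G ← 0]` (`AndOrTree.eval_cut`); all three pieces have at
   most `⌊2m/3⌋` leaves, so recursively `depth ≤ 2 · s(m)` with `s(m) = s(⌊2m/3⌋) + 1`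
   (`AndOrTree.exists_balanced`), and `s(m) ≤ 2 log₂ m + 1` (`AndOrTree.spiraSteps_le`).
4. Constants are cleaned out (`AndOrTree.clean`, never deeper) and the tree is re-linearised with
   `Circuit.binop` of `FormulaComposition` (`AndOrTree.toCircuit`; the new bookkeeping lemma is
   `Circuit.depth_binop`). A constant outcome is impossible since a constant-free monotone tree
   is `0` at `0⋯0` and `1` at `1⋯1`.

Everything here is proved; no new named facts.

## References

* [Jukna2012] S. Jukna, *Boolean Function Complexity*, Springer 2012, Lemma 6.1 (Formula
  Balancing Lemma) and §6.1, book pp. 159–160 (Spira 1971 with `c < 3.42`).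
* P. M. Spira, *On time-hardware complexity tradeoffs for Boolean functions*, Proc. 4th Hawaii
  Symp. System Sciences (1971) 525–527.
* [Vollmer1999] H. Vollmer, *Introduction to Circuit Complexity*, §1.2 (composition, depth).
-/

namespace Literature.Computability.Complexity

open Finset GateList

universe u

/-! ## 1. Monotone formula trees -/

/-- Binary `∧/∨` trees over the variables `ι`, with constant leaves (Jukna 2012, §1.2 and §6.1:
formulas as trees; the flag `true` is `∧`, `false` is `∨`). [cite: Jukna2012, §6.1] -/
inductive AndOrTree (ι : Type u) : Type u
  | const : Bool → AndOrTree ι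
  | leaf : ι → AndOrTree ι
  | node : Bool → AndOrTree ι → AndOrTree ι → AndOrTree ι

namespace AndOrTree

variable {ι : Type u}

/-- The connective: `bop true = ∧`, `bop false = ∨`. [folklore] -/
def bop (o a b : Bool) : Bool := cond o (a && b) (a || b)

/-- `bop true` is `∧`. [cite: Jukna2012, §1.2] -/
@[simp] theorem bop_true (a b : Bool) : bop true a b = (a && b) := rfl
/-- `bop false` is `∨`. [cite: Jukna2012, §1.2] -/
@[simp] theorem bop_false (a b : Bool) : bop false a b = (a || b) := rfl

/-- Evaluation of a tree. [cite: Jukna2012, §1.2] -/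
def eval : AndOrTree ι → (ι → Bool) → Bool
  | const b, _ => b
  | leaf i, x => x i
  | node o l r, x => bop o (l.eval x) (r.eval x)

/-- Leaf-size: the number of variable leaves (constants do not count). [cite: Jukna2012, §6.1] -/
def leaves : AndOrTree ι → ℕ
  | const _ => 0
  | leaf _ => 1
  | node _ l r => l.leaves + r.leaves

/-- Depth of a tree (leaves and constants have depth `0`). [cite: Jukna2012, §6.1] -/
def depth : AndOrTree ι → ℕ
  | const _ => 0
  | leaf _ => 0
  | node _ l r => max l.depth r.depth + 1

/-- Constant-freeness (no constant leaves). [cite: Jukna2012, §1.2] -/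
def NoConst : AndOrTree ι → Prop
  | const _ => False
  | leaf _ => True
  | node _ l r => l.NoConst ∧ r.NoConst

/-- A constant leaf evaluates to itself. [cite: Jukna2012, §1.2] -/
@[simp] theorem eval_const (b : Bool) (x : ι → Bool) : (const b : AndOrTree ι).eval x = b := rfl
/-- A variable leaf evaluates to the variable. [cite: Jukna2012, §1.2] -/
@[simp] theorem eval_leaf (i : ι) (x : ι → Bool) : (leaf i).eval x = x i := rfl
/-- A node applies its connective. [cite: Jukna2012, §1.2] -/
@[simp] theorem eval_node (o : Bool) (l r : AndOrTree ι) (x : ι → Bool) :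
    (node o l r).eval x = bop o (l.eval x) (r.eval x) := rfl
/-- Constants have no variable leaves. [cite: Jukna2012, §6.1] -/
@[simp] theorem leaves_const (b : Bool) : (const b : AndOrTree ι).leaves = 0 := rfl
/-- A variable leaf is one leaf. [cite: Jukna2012, §6.1] -/
@[simp] theorem leaves_leaf (i : ι) : (leaf i).leaves = 1 := rfl
/-- Leaf-size is additive over nodes. [cite: Jukna2012, §6.1] -/
@[simp] theorem leaves_node (o : Bool) (l r : AndOrTree ι) :
    (node o l r).leaves = l.leaves + r.leaves := rfl
/-- Constants have depth `0`. [cite: Jukna2012, §6.1] -/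
@[simp] theorem depth_const (b : Bool) : (const b : AndOrTree ι).depth = 0 := rfl
/-- Leaves have depth `0`. [cite: Jukna2012, §6.1] -/
@[simp] theorem depth_leaf (i : ι) : (leaf i : AndOrTree ι).depth = 0 := rfl
/-- A node is one deeper than its deeper subtree. [cite: Jukna2012, §6.1] -/
@[simp] theorem depth_node (o : Bool) (l r : AndOrTree ι) :
    (node o l r).depth = max l.depth r.depth + 1 := rfl
/-- A constant is not constant-free. [cite: Jukna2012, §1.2] -/
@[simp] theorem noConst_const (b : Bool) : ¬ (const b : AndOrTree ι).NoConst := fun h => h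
/-- A variable leaf is constant-free. [cite: Jukna2012, §1.2] -/
@[simp] theorem noConst_leaf (i : ι) : (leaf i).NoConst := trivial
/-- A node is constant-free iff both subtrees are. [cite: Jukna2012, §1.2] -/
@[simp] theorem noConst_node (o : Bool) (l r : AndOrTree ι) :
    (node o l r).NoConst ↔ l.NoConst ∧ r.NoConst := Iff.rfl

/-- A constant-free tree is `0` at the all-`0` input. [cite: Jukna2012, §1.2] -/
theorem eval_false_of_noConst : ∀ {t : AndOrTree ι}, t.NoConst → t.eval (fun _ => false) = false
  | const _, h => absurd h (noConst_const _)
  | leaf _, _ => rfl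
  | node o l r, h => by
    rw [eval_node, eval_false_of_noConst h.1, eval_false_of_noConst h.2]; cases o <;> rfl

/-- A constant-free tree is `1` at the all-`1` input. [cite: Jukna2012, §1.2] -/
theorem eval_true_of_noConst : ∀ {t : AndOrTree ι}, t.NoConst → t.eval (fun _ => true) = true
  | const _, h => absurd h (noConst_const _)
  | leaf _, _ => rfl
  | node o l r, h => by
    rw [eval_node, eval_true_of_noConst h.1, eval_true_of_noConst h.2]; cases o <;> rfl

/-- A constant-free tree has a leaf. [cite: Jukna2012, §6.1] -/
theorem one_le_leaves_of_noConst : ∀ {t : AndOrTree ι}, t.NoConst → 1 ≤ t.leaves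
  | const _, h => absurd h (noConst_const _)
  | leaf _, _ => le_rfl
  | node _ _ _, h => le_add_right (one_le_leaves_of_noConst h.1)

/-- A tree without variable leaves computes a constant. [cite: Jukna2012, §6.1] -/
theorem eval_eq_of_leaves_eq_zero : ∀ {t : AndOrTree ι}, t.leaves = 0 → ∀ x y, t.eval x = t.eval y
  | const _, _, _, _ => rfl
  | leaf _, h, _, _ => absurd h (by simp)
  | node o l r, h, x, y => by
    rw [leaves_node, add_eq_zero] at h
    rw [eval_node, eval_node, eval_eq_of_leaves_eq_zero h.1 x y, eval_eq_of_leaves_eq_zero h.2 x y]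

/-! ### Trees with at most one leaf have depth-`0` equivalents -/

/-- A monotone tree with at most one variable leaf is equivalent to a variable or a constant.
[cite: Jukna2012, Lemma 6.1 (proof idea, p. 160)] -/
theorem exists_depth_zero : ∀ (t : AndOrTree ι), t.leaves ≤ 1 →
    ∃ t' : AndOrTree ι, t'.depth = 0 ∧ ∀ x, t'.eval x = t.eval x
  | const b, _ => ⟨const b, rfl, fun _ => rfl⟩
  | leaf i, _ => ⟨leaf i, rfl, fun _ => rfl⟩
  | node o l r, h => by
    rw [leaves_node] at h
    by_cases hl : l.leaves = 0
    · obtain ⟨r', hr'd, hr'e⟩ := exists_depth_zero r (by omega)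
      have hc := eval_eq_of_leaves_eq_zero hl
      refine ⟨if l.eval (fun _ => false) = o then r' else const (l.eval fun _ => false), ?_, ?_⟩
      · split <;> simp [hr'd]
      · intro x
        rw [eval_node, hc x (fun _ => false), ← hr'e x]
        cases o <;> cases hb : l.eval (fun _ => false) <;> simp
    · have hr : r.leaves = 0 := by omega
      obtain ⟨l', hl'd, hl'e⟩ := exists_depth_zero l (by omega)
      have hc := eval_eq_of_leaves_eq_zero hr
      refine ⟨if r.eval (fun _ => false) = o then l' else const (r.eval fun _ => false), ?_, ?_⟩
      · split <;> simp [hl'd]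
      · intro x
        rw [eval_node, hc x (fun _ => false), ← hl'e x]
        cases o <;> cases hb : r.eval (fun _ => false) <;> simp

/-! ## 3. Spira's split -/

/-- **Spira's split.** `cut k t = (G, F)`: descend from the root of `t` into the heavier subtree
until it has at most `k` leaves; `G` is that subtree and `F b` is `t` with `G` replaced by the
constant `b` (Jukna 2012, proof idea of Lemma 6.1). [cite: Jukna2012, Lemma 6.1 (proof idea, p. 160)] -/
def cut (k : ℕ) : AndOrTree ι → AndOrTree ι × (Bool → AndOrTree ι)
  | node o l r =>
    if r.leaves ≤ l.leaves then
      (if l.leaves ≤ k then (l, fun b => node o (const b) r)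
       else ((cut k l).1, fun b => node o ((cut k l).2 b) r))
    else
      (if r.leaves ≤ k then (r, fun b => node o l (const b))
       else ((cut k r).1, fun b => node o l ((cut k r).2 b)))
  | const b => (const b, fun b' => const b')
  | leaf i => (leaf i, fun b' => const b')

/-- Pushing the split through a connective on the left argument. [folklore] -/
private theorem bop_split_left (o G C1 C0 R : Bool) :
    bop o ((G && C1) || C0) R = ((G && bop o C1 R) || bop o C0 R) := by
  cases o <;> cases G <;> cases C1 <;> cases C0 <;> cases R <;> rfl

/-- Pushing the split through a connective on the right argument. [folklore] -/
private theorem bop_split_right (o L G C1 C0 : Bool) :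
    bop o L ((G && C1) || C0) = ((G && bop o L C1) || bop o L C0) := by
  cases o <;> cases L <;> cases G <;> cases C1 <;> cases C0 <;> rfl

/-- The split at the left argument itself. [folklore] -/
private theorem bop_stop_left (o L R : Bool) :
    bop o L R = ((L && bop o true R) || bop o false R) := by
  cases o <;> cases L <;> cases R <;> rfl

/-- The split at the right argument itself. [folklore] -/
private theorem bop_stop_right (o L R : Bool) :
    bop o L R = ((R && bop o L true) || bop o L false) := by
  cases o <;> cases L <;> cases R <;> rfl

/-- **The split identity** `t ≡ (G ∧ t[G ← 1]) ∨ t[G ← 0]` (monotonicity).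
[cite: Jukna2012, Lemma 6.1 (proof idea, p. 160)] -/
theorem eval_cut (k : ℕ) : ∀ (t : AndOrTree ι) (x : ι → Bool),
    t.eval x = (((cut k t).1.eval x && ((cut k t).2 true).eval x) || ((cut k t).2 false).eval x)
  | const b, x => by cases b <;> rfl
  | leaf i, x => by simp [cut]
  | node o l r, x => by
    simp only [cut]
    split_ifs with h1 h2 h3
    · simpa using bop_stop_left o (l.eval x) (r.eval x)
    · simp only [eval_node]
      rw [eval_cut k l x]
      exact bop_split_left _ _ _ _ _
    · simpa using bop_stop_right o (l.eval x) (r.eval x)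
    · simp only [eval_node]
      rw [eval_cut k r x]
      exact bop_split_right _ _ _ _ _

/-- The cut-out subtree has at most `k` leaves. [cite: Jukna2012, Lemma 6.1 (proof idea, p. 160)] -/
theorem cut_leaves_le {k : ℕ} (hk : 1 ≤ k) : ∀ {t : AndOrTree ι}, k < t.leaves → (cut k t).1.leaves ≤ k
  | const _, h => absurd h (by simp)
  | leaf _, h => absurd h (by simp; omega)
  | node o l r, h => by
    simp only [cut]
    split_ifs with h1 h2 h3
    · exact h2
    · exact cut_leaves_le hk (not_le.1 h2)
    · exact h3
    · exact cut_leaves_le hk (not_le.1 h3)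

/-- The cut-out subtree has more than `k/2` leaves. [cite: Jukna2012, Lemma 6.1 (proof idea, p. 160)] -/
theorem lt_two_mul_cut_leaves {k : ℕ} : ∀ {t : AndOrTree ι}, k < t.leaves → k < 2 * (cut k t).1.leaves
  | const _, h => absurd h (by simp)
  | leaf _, h => by simp [cut] at h ⊢; omega
  | node o l r, h => by
    rw [leaves_node] at h
    simp only [cut]
    split_ifs with h1 h2 h3
    · dsimp only; omega
    · exact lt_two_mul_cut_leaves (not_le.1 h2)
    · dsimp only; omega
    · exact lt_two_mul_cut_leaves (not_le.1 h3)

/-- Leaf count of the split: the context plus the cut-out subtree. [cite: Jukna2012, Lemma 6.1 (proof idea, p. 160)] -/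
theorem cut_leaves_add (k : ℕ) : ∀ (t : AndOrTree ι) (b : Bool), 1 ≤ t.leaves →
    ((cut k t).2 b).leaves + (cut k t).1.leaves = t.leaves
  | const _, b, h => absurd h (by simp)
  | leaf _, b, _ => by simp [cut]
  | node o l r, b, _ => by
    simp only [cut]
    split_ifs with h1 h2 h3
    · simp; omega
    · have hl : 1 ≤ l.leaves := by omega
      have := cut_leaves_add k l b hl
      simp; omega
    · simp
    · have hr : 1 ≤ r.leaves := by omega
      have := cut_leaves_add k r b hr
      simp; omega

/-! ### The recursion depth `s(m) = s(⌊2m/3⌋) + 1` -/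

/-- Number of `2/3`-reduction steps from `m` leaves down to one leaf. [folklore] -/
def spiraSteps : ℕ → ℕ
  | m => if m ≤ 1 then 0 else spiraSteps (2 * m / 3) + 1
  decreasing_by omega

/-- No step is needed from at most one leaf. [cite: Jukna2012, §6.1] -/
theorem spiraSteps_of_le_one {m : ℕ} (h : m ≤ 1) : spiraSteps m = 0 := by
  rw [spiraSteps]; simp [h]

/-- One `2/3`-step from `m ≥ 2` leaves. [cite: Jukna2012, §6.1] -/
theorem spiraSteps_of_two_le {m : ℕ} (h : 2 ≤ m) : spiraSteps m = spiraSteps (2 * m / 3) + 1 := by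
  rw [spiraSteps]; simp [show ¬ m ≤ 1 by omega]

/-- `s` is monotone. [cite: Jukna2012, §6.1] -/
theorem spiraSteps_mono : ∀ (n m : ℕ), m ≤ n → spiraSteps m ≤ spiraSteps n := by
  intro n
  induction n using Nat.strong_induction_on with
  | _ n ih =>
    intro m hmn
    by_cases hm : m ≤ 1
    · rw [spiraSteps_of_le_one hm]; exact Nat.zero_le _
    · rw [spiraSteps_of_two_le (by omega), spiraSteps_of_two_le (show 2 ≤ n by omega)]
      exact Nat.succ_le_succ (ih _ (by omega) _ (by omega))

/-- `s(m) ≤ 2 log₂ m + 1` (two steps at least halve). [cite: Jukna2012, §6.1] -/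
theorem spiraSteps_le : ∀ m : ℕ, spiraSteps m ≤ 2 * Nat.log 2 m + 1 := by
  intro m
  induction m using Nat.strong_induction_on with
  | _ m ih =>
    by_cases hm : m ≤ 1
    · rw [spiraSteps_of_le_one hm]; exact Nat.zero_le _
    rw [spiraSteps_of_two_le (by omega)]
    have hL : 1 ≤ Nat.log 2 m := Nat.log_pos (by norm_num) (by omega)
    by_cases hm' : 2 * m / 3 ≤ 1
    · rw [spiraSteps_of_le_one hm']; omega
    rw [spiraSteps_of_two_le (by omega)]
    have h1 := ih (2 * (2 * m / 3) / 3) (by omega)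
    have h2 : Nat.log 2 (2 * (2 * m / 3) / 3) ≤ Nat.log 2 m - 1 := by
      rw [← Nat.log_div_base]
      exact Nat.log_mono_right (by omega)
    omega

/-! ### Balancing -/

/-- **Spira's theorem on trees**: a monotone tree with at most `m` leaves is equivalent to one
of depth at most `2 s(m)`. [cite: Jukna2012, Lemma 6.1] -/
theorem exists_balanced : ∀ (m : ℕ) (t : AndOrTree ι), t.leaves ≤ m →
    ∃ t' : AndOrTree ι, (∀ x, t'.eval x = t.eval x) ∧ t'.depth ≤ 2 * spiraSteps m := by
  intro m
  induction m using Nat.strong_induction_on with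
  | _ m ih =>
    intro t htm
    by_cases ht1 : t.leaves ≤ 1
    · obtain ⟨t', hd, he⟩ := exists_depth_zero t ht1
      exact ⟨t', he, by simp [hd]⟩
    -- `m' = t.leaves ≥ 2`, threshold `k = ⌊2 m'/3⌋`
    set m' := t.leaves with hm'
    set k := 2 * m' / 3 with hk
    have hk1 : 1 ≤ k := by omega
    have hkm : k < m' := by omega
    have hkm3 : k ≤ 2 * m / 3 := by omega
    have hlt : 2 * m / 3 < m := by omega
    have hG : (cut k t).1.leaves ≤ k := cut_leaves_le hk1 (by omega)
    have hG' : k < 2 * (cut k t).1.leaves := lt_two_mul_cut_leaves (by omega)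
    have hF : ∀ b, ((cut k t).2 b).leaves ≤ k := by
      intro b
      have := cut_leaves_add k t b (by omega)
      omega
    obtain ⟨G', hG'e, hG'd⟩ := ih _ hlt (cut k t).1 (hG.trans hkm3)
    obtain ⟨F1, hF1e, hF1d⟩ := ih _ hlt ((cut k t).2 true) ((hF true).trans hkm3)
    obtain ⟨F0, hF0e, hF0d⟩ := ih _ hlt ((cut k t).2 false) ((hF false).trans hkm3)
    refine ⟨node false (node true G' F1) F0, fun x => ?_, ?_⟩
    · rw [eval_cut k t x, eval_node, eval_node, hG'e, hF1e, hF0e]; rfl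
    · rw [spiraSteps_of_two_le (show 2 ≤ m by omega), depth_node, depth_node]
      omega

/-! ## 4a. Cleaning out the constants -/

/-- Smart connective: absorbs a constant argument (`1 ∧ t = t`, `0 ∧ t = 0`, `1 ∨ t = 1`,
`0 ∨ t = t`). [folklore] -/
def smart (o : Bool) : AndOrTree ι → AndOrTree ι → AndOrTree ι
  | const b, t => if b = o then t else const b
  | leaf i, const b => if b = o then leaf i else const b
  | node o' l r, const b => if b = o then node o' l r else const b
  | leaf i, leaf j => node o (leaf i) (leaf j)
  | leaf i, node o' l r => node o (leaf i) (node o' l r)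
  | node o' l r, leaf j => node o (node o' l r) (leaf j)
  | node o' l r, node o'' l' r' => node o (node o' l r) (node o'' l' r')

/-- The smart connective computes the connective. [cite: Jukna2012, §1.2] -/
theorem eval_smart (o : Bool) (l r : AndOrTree ι) (x : ι → Bool) :
    (smart o l r).eval x = bop o (l.eval x) (r.eval x) := by
  cases l <;> cases r <;> simp only [smart, eval_node] <;> (try split) <;> cases o <;> simp_all

/-- The smart connective is not deeper than the plain one. [cite: Jukna2012, §1.2] -/
theorem depth_smart_le (o : Bool) (l r : AndOrTree ι) :
    (smart o l r).depth ≤ max l.depth r.depth + 1 := by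
  cases l <;> cases r <;> simp only [smart, depth_node] <;> (try split) <;> simp

/-- `Clean t`: constant-free, or a bare constant. [cite: Jukna2012, §1.2] -/
def Clean (t : AndOrTree ι) : Prop := t.NoConst ∨ ∃ b, t = const b

/-- The smart connective of clean trees is clean. [cite: Jukna2012, §1.2] -/
theorem clean_smart (o : Bool) {l r : AndOrTree ι} (hl : Clean l) (hr : Clean r) : Clean (smart o l r) := by
  rcases hl with hl | ⟨b, rfl⟩ <;> rcases hr with hr | ⟨b', rfl⟩
  · cases l <;> cases r <;> simp_all [smart, Clean]
  · cases l
    · exact absurd hl (noConst_const _)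
    · simp only [smart]; split
      · exact Or.inl hl
      · exact Or.inr ⟨_, rfl⟩
    · simp only [smart]; split
      · exact Or.inl hl
      · exact Or.inr ⟨_, rfl⟩
  · simp only [smart]; split
    · exact Or.inl hr
    · exact Or.inr ⟨_, rfl⟩
  · simp only [smart]; split
    · exact Or.inr ⟨_, rfl⟩
    · exact Or.inr ⟨_, rfl⟩

/-- Constant propagation through the whole tree. [folklore] -/
def clean : AndOrTree ι → AndOrTree ι
  | node o l r => smart o (clean l) (clean r)
  | const b => const b
  | leaf i => leaf i

/-- Constant propagation preserves the computed function. [cite: Jukna2012, §1.2] -/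
theorem eval_clean : ∀ (t : AndOrTree ι) (x : ι → Bool), (clean t).eval x = t.eval x
  | const _, _ => rfl
  | leaf _, _ => rfl
  | node o l r, x => by rw [clean, eval_smart, eval_clean l x, eval_clean r x, eval_node]

/-- Constant propagation does not increase depth. [cite: Jukna2012, §1.2] -/
theorem depth_clean_le : ∀ t : AndOrTree ι, (clean t).depth ≤ t.depth
  | const _ => le_rfl
  | leaf _ => le_rfl
  | node o l r => by
    rw [clean, depth_node]
    refine (depth_smart_le o _ _).trans ?_
    have := depth_clean_le l
    have := depth_clean_le r
    omega

/-- Constant propagation yields a constant-free tree or a bare constant. [cite: Jukna2012, §1.2] -/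
theorem clean_clean : ∀ t : AndOrTree ι, Clean (clean t)
  | const b => Or.inr ⟨b, rfl⟩
  | leaf _ => Or.inl trivial
  | node o l r => by rw [clean]; exact clean_smart o (clean_clean l) (clean_clean r)

end AndOrTree

/-! ## 4b. Re-linearisation: trees to straight-line formulas -/

namespace Circuit

variable {ι : Type u}

/-- Depth of a relocated (not rewired) wire. [folklore] -/
private theorem wireDepthOf_append_shift (ds ws : List ℕ) (w : ι ⊕ ℕ) :
    wireDepthOf (ds ++ ws) (shiftWire (fun i => (Sum.inl i : ι ⊕ ℕ)) ds.length w) =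
      wireDepthOf ws w := by
  cases w with
  | inl i => rfl
  | inr m =>
    simp only [shiftWire, wireDepthOf_inr, List.getD_eq_getElem?_getD]
    rw [List.getElem?_append_right (by omega)]
    congr 2
    omega

/-- Depths of juxtaposed blocks. [folklore] -/
private theorem wdepths_append_reloc (w : GateFn → ℕ) (gs gs' : List (Gate ι)) :
    wdepths w (gs ++ gs'.map (reloc (fun i => (Sum.inl i : ι ⊕ ℕ)) gs.length)) =
      wdepths w gs ++ wdepths w gs' := by
  induction gs' using List.reverseRecOn with
  | nil => simp
  | append_singleton gs' g ih =>
    rw [List.map_append, List.map_singleton, ← List.append_assoc, wdepths_append_singleton, ih,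
      wdepths_append_singleton, List.append_assoc]
    congr 2
    simp only [reloc_fn, List.cons.injEq, and_true]
    congr 1
    refine Finset.sup_congr rfl fun a _ => ?_
    have hlen : (wdepths w gs).length = gs.length := length_wdepths w gs
    rw [← hlen]
    exact wireDepthOf_append_shift (wdepths w gs) (wdepths w gs') (g.args a)

/-- The gate-free input circuit has depth `0`. [cite: Vollmer1999, §1.1] -/
@[simp] theorem depth_input (i : ι) : (input i : Circuit ι).depth = 0 := rfl

/-- **Depth of `C₁ ⋄ C₂`**: one more than the deeper argument (Vollmer 1999, §1.2).
[cite: Vollmer1999, §1.2] -/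
theorem depth_binop (op : (Fin 2 → Bool) → Bool) (C₁ C₂ : Circuit ι) :
    (binop op C₁ C₂).depth = max C₁.depth C₂.depth + 1 := by
  have hlen : (C₁.gates ++ C₂.gates.map (reloc (fun i => (Sum.inl i : ι ⊕ ℕ)) C₁.gates.length)).length
      = C₁.gates.length + C₂.gates.length := by simp
  have hd1 : wireDepthOf (wdepths (fun _ => 1) C₁.gates ++ wdepths (fun _ => 1) C₂.gates)
      C₁.output = C₁.depth := by
    rw [Circuit.depth, circuit_depthWith]
    exact wireDepthOf_append_of_lt _ _ _ fun m hm => by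
      rw [length_wdepths]; exact C₁.wf_output m hm
  have hd2 : wireDepthOf (wdepths (fun _ => 1) C₁.gates ++ wdepths (fun _ => 1) C₂.gates)
      (shiftWire (fun i => (Sum.inl i : ι ⊕ ℕ)) C₁.gates.length C₂.output) = C₂.depth := by
    rw [Circuit.depth, circuit_depthWith C₂, ← length_wdepths (fun _ => 1) C₁.gates]
    exact wireDepthOf_append_shift _ _ _
  have hsup : (univ.sup fun a : Fin 2 => wireDepthOf
      (wdepths (fun _ => 1) C₁.gates ++ wdepths (fun _ => 1) C₂.gates)
        (![C₁.output, shiftWire (fun i => (Sum.inl i : ι ⊕ ℕ)) C₁.gates.length C₂.output] a)) =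
      max C₁.depth C₂.depth := by
    apply le_antisymm
    · refine Finset.sup_le fun a _ => ?_
      refine Fin.cases ?_ (fun a => ?_) a
      · simp only [Matrix.cons_val_zero]
        rw [hd1]; exact le_max_left _ _
      · have ha : a = 0 := Fin.fin_one_eq_zero a
        subst ha
        simp only [Matrix.cons_val_succ, Matrix.cons_val_fin_one]
        rw [hd2]; exact le_max_right _ _
    · refine max_le ?_ ?_
      · have := Finset.le_sup (f := fun a : Fin 2 => wireDepthOf
          (wdepths (fun _ => 1) C₁.gates ++ wdepths (fun _ => 1) C₂.gates)
            (![C₁.output, shiftWire (fun i => (Sum.inl i : ι ⊕ ℕ)) C₁.gates.length C₂.output] a))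
          (mem_univ 0)
        simp only [Matrix.cons_val_zero] at this
        rwa [hd1] at this
      · have := Finset.le_sup (f := fun a : Fin 2 => wireDepthOf
          (wdepths (fun _ => 1) C₁.gates ++ wdepths (fun _ => 1) C₂.gates)
            (![C₁.output, shiftWire (fun i => (Sum.inl i : ι ⊕ ℕ)) C₁.gates.length C₂.output] a))
          (mem_univ 1)
        simp only [Matrix.cons_val_one, Matrix.cons_val_fin_one] at this
        rwa [hd2] at this
  rw [Circuit.depth, circuit_depthWith]
  change wireDepthOf (wdepths (fun _ => 1)
      ((C₁.gates ++ C₂.gates.map (reloc (fun i => (Sum.inl i : ι ⊕ ℕ)) C₁.gates.length)) ++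
        [⟨2, op, ![C₁.output, shiftWire (fun i => (Sum.inl i : ι ⊕ ℕ)) C₁.gates.length C₂.output]⟩]))
      (.inr (C₁.gates.length + C₂.gates.length) : ι ⊕ ℕ) = _
  rw [← hlen, wireDepthOf_inr, getD_wdepths_append_singleton, wdepths_append_reloc]
  change 1 + (univ.sup fun a : Fin 2 => wireDepthOf
      (wdepths (fun _ => 1) C₁.gates ++ wdepths (fun _ => 1) C₂.gates)
        (![C₁.output, shiftWire (fun i => (Sum.inl i : ι ⊕ ℕ)) C₁.gates.length C₂.output] a)) = _
  rw [hsup, add_comm]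

end Circuit

namespace AndOrTree

variable {ι : Type u}

/-- The truth table of the connective `o` as a binary gate function. [folklore] -/
def opOf (o : Bool) : (Fin 2 → Bool) → Bool := if o then (GateFn.and 2).2 else (GateFn.or 2).2

/-- The gate function of `o` on a pair of values is the connective `o`. [cite: Jukna2012, §1.2] -/
theorem opOf_pair (o a b : Bool) : opOf o ![a, b] = bop o a b := by
  cases o <;> simp [opOf]

/-- The gate function of `o` lies in the monotone basis `{∧₂, ∨₂}`. [cite: Jukna2012, §1.2] -/
theorem opOf_mem (o : Bool) : (⟨2, opOf o⟩ : GateFn) ∈ monotoneBasis := by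
  cases o
  · exact Circuit.or_two_mem_monotoneBasis
  · exact Circuit.and_two_mem_monotoneBasis

/-- **Re-linearisation**: a tree as a straight-line formula (`binop` of `FormulaComposition`;
constants are sent to the one-gate constant circuit and are not used). [cite: Vollmer1999, §1.2] -/
def toCircuit : AndOrTree ι → Circuit ι
  | const b => Circuit.const ι b
  | leaf i => Circuit.input i
  | node o l r => Circuit.binop (opOf o) l.toCircuit r.toCircuit

/-- The re-linearised formula computes the tree. [cite: Vollmer1999, §1.2] -/
theorem eval_toCircuit : ∀ {t : AndOrTree ι}, t.NoConst → ∀ x, t.toCircuit.eval x = t.eval x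
  | const _, h, _ => absurd h (noConst_const _)
  | leaf _, _, _ => rfl
  | node o l r, h, x => by
    rw [toCircuit, Circuit.eval_binop, eval_toCircuit h.1, eval_toCircuit h.2, opOf_pair, eval_node]

/-- The re-linearised formula is over the monotone basis. [cite: Vollmer1999, §1.2] -/
theorem isOver_toCircuit : ∀ {t : AndOrTree ι}, t.NoConst → t.toCircuit.IsOver monotoneBasis
  | const _, h => absurd h (noConst_const _)
  | leaf i, _ => Circuit.isOver_input _ i
  | node o _ _, h => Circuit.isOver_binop (opOf_mem o) (isOver_toCircuit h.1) (isOver_toCircuit h.2)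

/-- The re-linearised formula is a (clean) formula: every gate is read at most once and the output gate by nobody. [cite: Vollmer1999, §1.2] -/
theorem isFormula_toCircuit : ∀ {t : AndOrTree ι}, t.NoConst →
    t.toCircuit.IsFormula ∧ ∀ m, t.toCircuit.output = .inr m → t.toCircuit.refCount m = 0
  | const _, h => absurd h (noConst_const _)
  | leaf i, _ => Circuit.isFormula_input i
  | node o _ _, h => by
    rw [toCircuit]
    exact Circuit.isFormula_binop _ (isFormula_toCircuit h.1).1 (isFormula_toCircuit h.1).2
      (isFormula_toCircuit h.2).1 (isFormula_toCircuit h.2).2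

/-- The re-linearised formula has the depth of the tree. [cite: Vollmer1999, §1.2] -/
theorem depth_toCircuit : ∀ {t : AndOrTree ι}, t.NoConst → t.toCircuit.depth = t.depth
  | const _, h => absurd h (noConst_const _)
  | leaf i, _ => Circuit.depth_input i
  | node o l r, h => by
    rw [toCircuit, Circuit.depth_binop, depth_toCircuit h.1, depth_toCircuit h.2, depth_node]

end AndOrTree

/-! ## 2. Unfolding a straight-line monotone formula into a tree -/

namespace GateList

variable {ι : Type u}

/-- The tree of a wire, given the trees `ts` of the gates computed so far (junk: `const false`).
[folklore] -/
def wireTree (ts : List (AndOrTree ι)) : ι ⊕ ℕ → AndOrTree ι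
  | .inl i => AndOrTree.leaf i
  | .inr m => ts.getD m (AndOrTree.const false)

/-- The tree of an input wire is a variable leaf. [cite: Vollmer1999, §1.1] -/
@[simp] theorem wireTree_inl (ts : List (AndOrTree ι)) (i : ι) : wireTree ts (.inl i) = AndOrTree.leaf i := rfl
/-- The tree of a gate wire is the recorded tree. [cite: Vollmer1999, §1.1] -/
@[simp] theorem wireTree_inr (ts : List (AndOrTree ι)) (m : ℕ) :
    wireTree ts (.inr m) = ts.getD m (AndOrTree.const false) := rfl

/-- An `∧₂` gate has fan-in `2`. [cite: Vollmer1999, §1.1] -/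
theorem arity_eq_two_of_and {g : Gate ι} (h : g.fn = GateFn.and 2) : g.arity = 2 :=
  congrArg Sigma.fst h

/-- An `∨₂` gate has fan-in `2`. [cite: Vollmer1999, §1.1] -/
theorem arity_eq_two_of_or {g : Gate ι} (h : g.fn = GateFn.or 2) : g.arity = 2 :=
  congrArg Sigma.fst h

open Classical in
/-- The tree of one more gate: an `∧₂`/`∨₂` node on the trees of its two argument wires
(junk `const false` for other gates). [cite: Jukna2012, §1.2] -/
noncomputable def gateTree (ts : List (AndOrTree ι)) (g : Gate ι) : AndOrTree ι :=
  if h : g.fn = GateFn.and 2 then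
    AndOrTree.node true (wireTree ts (g.args (Fin.cast (arity_eq_two_of_and h).symm 0)))
      (wireTree ts (g.args (Fin.cast (arity_eq_two_of_and h).symm 1)))
  else if h' : g.fn = GateFn.or 2 then
    AndOrTree.node false (wireTree ts (g.args (Fin.cast (arity_eq_two_of_or h').symm 0)))
      (wireTree ts (g.args (Fin.cast (arity_eq_two_of_or h').symm 1)))
  else AndOrTree.const false

/-- **Shape of the tree of a monotone gate**: a node on its two argument wires, computing the
gate. [cite: Jukna2012, §1.2] -/
theorem gateTree_shape (ts : List (AndOrTree ι)) {g : Gate ι} (hg : g.fn ∈ monotoneBasis) :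
    ∃ (o : Bool) (h : g.arity = 2),
      gateTree ts g = AndOrTree.node o (wireTree ts (g.args (Fin.cast h.symm 0)))
        (wireTree ts (g.args (Fin.cast h.symm 1))) ∧
      ∀ w : Fin g.arity → Bool, g.op w = AndOrTree.bop o (w (Fin.cast h.symm 0)) (w (Fin.cast h.symm 1)) := by
  simp only [monotoneBasis, Set.mem_insert_iff, Set.mem_singleton_iff] at hg
  rcases hg with h | h
  · refine ⟨true, arity_eq_two_of_and h, by rw [gateTree, dif_pos h], ?_⟩
    obtain ⟨k, op, args⟩ := g
    simp only [Gate.fn, GateFn.and, Sigma.mk.inj_iff] at h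
    obtain ⟨rfl, hop⟩ := h
    simp only [heq_eq_eq] at hop
    subst hop
    intro w
    simp [Fin.forall_fin_two]
  · have hn : ¬ g.fn = GateFn.and 2 := fun h' => gateFn_and_two_ne_or_two (h'.symm.trans h)
    refine ⟨false, arity_eq_two_of_or h, by rw [gateTree, dif_neg hn, dif_pos h], ?_⟩
    obtain ⟨k, op, args⟩ := g
    simp only [Gate.fn, GateFn.or, Sigma.mk.inj_iff] at h
    obtain ⟨rfl, hop⟩ := h
    simp only [heq_eq_eq] at hop
    subst hop
    intro w
    simp [Fin.exists_fin_two]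

/-- The trees of all gates of a straight-line program, in program order (same left fold as
`GateList.vals`). [cite: Jukna2012, §1.2] -/
noncomputable def trees (gs : List (Gate ι)) : List (AndOrTree ι) :=
  gs.foldl (fun ts g => ts ++ [gateTree ts g]) []

/-- The empty program has no trees. [cite: AroraBarak2009, Rem. 6.4] -/
@[simp] theorem trees_nil : trees ([] : List (Gate ι)) = [] := rfl

/-- One more gate appends its tree. [cite: AroraBarak2009, Rem. 6.4] -/
theorem trees_append_singleton (gs : List (Gate ι)) (g : Gate ι) :
    trees (gs ++ [g]) = trees gs ++ [gateTree (trees gs) g] := by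
  simp [trees, List.foldl_append]

/-- A program with `L` gates has `L` trees. [cite: AroraBarak2009, Rem. 6.4] -/
@[simp] theorem length_trees (gs : List (Gate ι)) : (trees gs).length = gs.length := by
  induction gs using List.reverseRecOn with
  | nil => rfl
  | append_singleton gs g ih => simp [trees_append_singleton, ih]

/-- Trees are stable under appending further gates. [cite: AroraBarak2009, Rem. 6.4] -/
theorem trees_append_take (gs gs' : List (Gate ι)) : ∃ ws, trees (gs ++ gs') = trees gs ++ ws := by
  induction gs' using List.reverseRecOn with
  | nil => exact ⟨[], by simp⟩
  | append_singleton gs' g ih =>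
    obtain ⟨ws, hws⟩ := ih
    exact ⟨ws ++ [gateTree (trees (gs ++ gs')) g], by
      rw [← List.append_assoc, trees_append_singleton, hws, List.append_assoc]⟩

/-- The tree of a gate of `gs` is unchanged in `gs ++ gs'`. [cite: AroraBarak2009, Rem. 6.4] -/
theorem getD_trees_append_of_lt (gs gs' : List (Gate ι)) {m : ℕ} (hm : m < gs.length) (d : AndOrTree ι) :
    (trees (gs ++ gs')).getD m d = (trees gs).getD m d := by
  obtain ⟨ws, h⟩ := trees_append_take gs gs'
  rw [h, List.getD_eq_getElem?_getD, List.getD_eq_getElem?_getD,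
    List.getElem?_append_left (by simpa using hm)]

/-- The tree of the gate at position `gs.length` of `gs ++ [g]`. [cite: AroraBarak2009, Rem. 6.4] -/
theorem getD_trees_append_singleton (gs : List (Gate ι)) (g : Gate ι) (d : AndOrTree ι) :
    (trees (gs ++ [g])).getD gs.length d = gateTree (trees gs) g := by
  rw [trees_append_singleton, List.getD_eq_getElem?_getD, List.getElem?_append_right (by simp),
    length_trees, Nat.sub_self]
  simp

/-- **The trees of a monotone program compute its gates and are constant-free.**
[cite: Jukna2012, §1.2] -/
theorem trees_spec : ∀ (gs : List (Gate ι)), WF gs → (∀ g ∈ gs, g.fn ∈ monotoneBasis) →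
    ∀ j, j < gs.length →
      (∀ x, ((trees gs).getD j (AndOrTree.const false)).eval x = (vals gs x).getD j false) ∧
        ((trees gs).getD j (AndOrTree.const false)).NoConst := by
  intro gs
  induction gs using List.reverseRecOn with
  | nil => intro _ _ j hj; simp at hj
  | append_singleton pre g ih =>
    intro hwf hB j hj
    have hwf' : WF pre := hwf.of_append_left
    have hB' : ∀ g' ∈ pre, g'.fn ∈ monotoneBasis := fun g' hg' => hB g' (by simp [hg'])
    have hgB : g.fn ∈ monotoneBasis := hB g (by simp)
    simp only [List.length_append, List.length_singleton] at hj
    by_cases hjp : j < pre.length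
    · rw [getD_trees_append_of_lt pre [g] hjp]
      refine ⟨fun x => ?_, (ih hwf' hB' j hjp).2⟩
      rw [(ih hwf' hB' j hjp).1 x]
      have := wireOf_vals_append pre [g] x (.inr j) (fun m hm => by cases hm; exact hjp)
      simpa using this.symm
    · obtain rfl : j = pre.length := by omega
      rw [getD_trees_append_singleton]
      have hOK : GateOK pre.length g := hwf.gateOK_mid (post := [])
      obtain ⟨o, har, hshape, hop⟩ := gateTree_shape (trees pre) hgB
      -- the argument wires
      have harg : ∀ a : Fin g.arity,
          (∀ x, (wireTree (trees pre) (g.args a)).eval x = wireOf x (vals pre x) (g.args a)) ∧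
            (wireTree (trees pre) (g.args a)).NoConst := by
        intro a
        cases ha : g.args a with
        | inl i => exact ⟨fun x => rfl, trivial⟩
        | inr m =>
          have hm : m < pre.length := hOK a m ha
          exact ⟨fun x => by rw [wireTree_inr, wireOf_inr]; exact (ih hwf' hB' m hm).1 x,
            by rw [wireTree_inr]; exact (ih hwf' hB' m hm).2⟩
      rw [hshape]
      refine ⟨fun x => ?_, (harg _).2, (harg _).2⟩
      rw [show pre ++ [g] = pre ++ g :: [] from rfl, getD_vals_append_cons, hop, AndOrTree.eval_node,
        (harg _).1 x, (harg _).1 x]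

/-! ### Fan-out one and the leaf potential -/

/-- Positional fan-out-`1`: two gates reading the same gate wire are the same gate.
[cite: Jukna2012, §1.2] -/
def FanOutOne (gs : List (Gate ι)) : Prop :=
  ∀ (j₁ j₂ : ℕ) (g₁ g₂ : Gate ι) (a₁ : Fin g₁.arity) (a₂ : Fin g₂.arity) (m : ℕ),
    gs[j₁]? = some g₁ → gs[j₂]? = some g₂ → g₁.args a₁ = .inr m → g₂.args a₂ = .inr m → j₁ = j₂

/-- Positional slot-injectivity: a gate reads a gate wire in at most one slot.
[cite: Jukna2012, §1.2] -/
def SlotInj (gs : List (Gate ι)) : Prop :=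
  ∀ (j : ℕ) (g : Gate ι) (a₁ a₂ : Fin g.arity) (m : ℕ),
    gs[j]? = some g → g.args a₁ = .inr m → g.args a₂ = .inr m → a₁ = a₂

/-- The property is inherited by prefixes of the program. [cite: Jukna2012, §1.2] -/
theorem FanOutOne.of_append_left {gs gs' : List (Gate ι)} (h : FanOutOne (gs ++ gs')) :
    FanOutOne gs := by
  intro j₁ j₂ g₁ g₂ a₁ a₂ m h₁ h₂ e₁ e₂
  have hj₁ : j₁ < gs.length := (List.getElem?_eq_some_iff.1 h₁).1
  have hj₂ : j₂ < gs.length := (List.getElem?_eq_some_iff.1 h₂).1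
  exact h j₁ j₂ g₁ g₂ a₁ a₂ m (by rwa [List.getElem?_append_left hj₁])
    (by rwa [List.getElem?_append_left hj₂]) e₁ e₂

/-- The property is inherited by prefixes of the program. [cite: Jukna2012, §1.2] -/
theorem SlotInj.of_append_left {gs gs' : List (Gate ι)} (h : SlotInj (gs ++ gs')) : SlotInj gs := by
  intro j g a₁ a₂ m hj e₁ e₂
  have hj' : j < gs.length := (List.getElem?_eq_some_iff.1 hj).1
  exact h j g a₁ a₂ m (by rwa [List.getElem?_append_left hj']) e₁ e₂

/-- `m` is read by no gate of `gs`. [cite: Jukna2012, §1.2] -/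
def Unref (gs : List (Gate ι)) (m : ℕ) : Prop :=
  ∀ (j : ℕ) (g : Gate ι) (a : Fin g.arity), gs[j]? = some g → g.args a ≠ .inr m

/-- An entry of a list of naturals is at most the sum. [folklore] -/
private theorem le_sum_of_getElem : ∀ (l : List ℕ) (i : ℕ) (hi : i < l.length), l[i] ≤ l.sum
  | [], i, hi => absurd hi (by simp)
  | a :: l, 0, _ => by simp
  | a :: l, i + 1, hi => by
    rw [List.sum_cons]
    have := le_sum_of_getElem l i (by simpa using hi)
    simp only [List.getElem_cons_succ]
    omega

/-- Two distinct entries of a list of naturals sum to at most the sum. [folklore] -/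
private theorem add_le_sum_of_getElem : ∀ (l : List ℕ) (i j : ℕ) (hi : i < l.length)
    (hj : j < l.length), i < j → l[i] + l[j] ≤ l.sum
  | [], i, j, hi, _, _ => absurd hi (by simp)
  | a :: l, i, 0, _, _, h => absurd h (Nat.not_lt_zero _)
  | a :: l, 0, j + 1, _, hj, _ => by
    rw [List.sum_cons]
    have := le_sum_of_getElem l j (by simpa using hj)
    simp only [List.getElem_cons_zero, List.getElem_cons_succ]
    omega
  | a :: l, i + 1, j + 1, hi, hj, h => by
    rw [List.sum_cons]
    have := add_le_sum_of_getElem l i j (by simpa using hi) (by simpa using hj) (by omega)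
    simp only [List.getElem_cons_succ]
    omega

end GateList

namespace Circuit

variable {ι : Type u}

/-- A slot wired to `m` makes `slotCount m ≥ 1`. [folklore] -/
private theorem one_le_slotCount {g : Gate ι} {a : Fin g.arity} {m : ℕ} (h : g.args a = .inr m) :
    1 ≤ Gate.slotCount m g := by
  unfold Gate.slotCount
  rw [Nat.one_le_iff_ne_zero, Ne, card_eq_zero, ← Ne, ← nonempty_iff_ne_empty]
  exact ⟨a, by simp [h]⟩

/-- Two distinct slots wired to `m` make `slotCount m ≥ 2`. [folklore] -/
private theorem two_le_slotCount {g : Gate ι} {a₁ a₂ : Fin g.arity} {m : ℕ}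
    (h₁ : g.args a₁ = .inr m) (h₂ : g.args a₂ = .inr m) (hne : a₁ ≠ a₂) :
    2 ≤ Gate.slotCount m g := by
  unfold Gate.slotCount
  calc 2 = ({a₁, a₂} : Finset (Fin g.arity)).card := (card_pair hne).symm
    _ ≤ _ := card_le_card fun a ha => by
        simp only [mem_insert, mem_singleton] at ha
        rcases ha with rfl | rfl <;> simp [h₁, h₂]

/-- **A formula has fan-out one** (positional form). [cite: Jukna2012, §1.2] -/
theorem IsFormula.fanOutOne {C : Circuit ι} (hF : C.IsFormula) : GateList.FanOutOne C.gates := by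
  intro j₁ j₂ g₁ g₂ a₁ a₂ m h₁ h₂ e₁ e₂
  by_contra hne
  obtain ⟨hj₁, rfl⟩ := List.getElem?_eq_some_iff.1 h₁
  obtain ⟨hj₂, rfl⟩ := List.getElem?_eq_some_iff.1 h₂
  have key : 2 ≤ C.refCount m := by
    rw [refCount_eq_sum_slotCount]
    have hl₁ : j₁ < (C.gates.map (Gate.slotCount m)).length := by simpa using hj₁
    have hl₂ : j₂ < (C.gates.map (Gate.slotCount m)).length := by simpa using hj₂
    rcases lt_or_gt_of_ne hne with hlt | hlt
    · have := GateList.add_le_sum_of_getElem _ j₁ j₂ hl₁ hl₂ hlt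
      simp only [List.getElem_map] at this
      have := one_le_slotCount e₁; have := one_le_slotCount e₂; omega
    · have := GateList.add_le_sum_of_getElem _ j₂ j₁ hl₂ hl₁ hlt
      simp only [List.getElem_map] at this
      have := one_le_slotCount e₁; have := one_le_slotCount e₂; omega
  have := hF m
  omega

/-- **A formula is slot-injective** (positional form). [cite: Jukna2012, §1.2] -/
theorem IsFormula.slotInj {C : Circuit ι} (hF : C.IsFormula) : GateList.SlotInj C.gates := by
  intro j g a₁ a₂ m hj e₁ e₂
  by_contra hne
  obtain ⟨hj', rfl⟩ := List.getElem?_eq_some_iff.1 hj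
  have key : 2 ≤ C.refCount m := by
    rw [refCount_eq_sum_slotCount]
    have hl : j < (C.gates.map (Gate.slotCount m)).length := by simpa using hj'
    have := GateList.le_sum_of_getElem _ j hl
    simp only [List.getElem_map] at this
    have := two_le_slotCount e₁ e₂ hne
    omega
  have := hF m
  omega

end Circuit

namespace GateList

variable {ι : Type u}

open Classical in
/-- **The fan-out-one leaf potential.** In a well-formed monotone formula program, summing
`leaves − 1` over the trees of the gates read by nobody gives at most the number of gates.
[cite: Jukna2012, §6.1 (a formula with `ℓ` gates has `ℓ + 1` leaves)] -/
theorem leaves_potential : ∀ (gs : List (Gate ι)), WF gs → (∀ g ∈ gs, g.fn ∈ monotoneBasis) →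
    FanOutOne gs → SlotInj gs →
      ∑ m ∈ (range gs.length).filter (Unref gs),
        (((trees gs).getD m (AndOrTree.const false)).leaves - 1) ≤ gs.length := by
  intro gs
  induction gs using List.reverseRecOn with
  | nil => intros; simp
  | append_singleton pre g ih =>
    intro hwf hB hF1 hSI
    have hwf' : WF pre := hwf.of_append_left
    have hB' : ∀ g' ∈ pre, g'.fn ∈ monotoneBasis := fun g' hg' => hB g' (by simp [hg'])
    have hgB : g.fn ∈ monotoneBasis := hB g (by simp)
    have IH := ih hwf' hB' hF1.of_append_left hSI.of_append_left
    have hOK : GateOK pre.length g := hwf.gateOK_mid (post := [])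
    have hget : (pre ++ [g])[pre.length]? = some g := by simp
    -- notation
    set L : ℕ → ℕ := fun m => ((trees pre).getD m (AndOrTree.const false)).leaves with hL
    set R : Finset ℕ := (range pre.length).filter fun m => ∃ a : Fin g.arity, g.args a = .inr m
      with hR
    -- the new reference-free set
    have hU : ∀ m, m < pre.length → (Unref (pre ++ [g]) m ↔ Unref pre m ∧ m ∉ R) := by
      intro m hm
      constructor
      · intro h
        refine ⟨fun j g' a hj => h j g' a (by
          have hj' : j < pre.length := (List.getElem?_eq_some_iff.1 hj).1
          rwa [List.getElem?_append_left hj']), fun hmR => ?_⟩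
        simp only [hR, mem_filter, mem_range] at hmR
        obtain ⟨a, ha⟩ := hmR.2
        exact h pre.length g a hget ha
      · rintro ⟨h, hmR⟩ j g' a hj
        by_cases hj' : j < pre.length
        · rw [List.getElem?_append_left hj'] at hj; exact h j g' a hj
        · have hj'' : j = pre.length := by
            have := (List.getElem?_eq_some_iff.1 hj).1; simp at this; omega
          subst hj''
          rw [hget, Option.some.injEq] at hj
          subst hj
          intro ha
          exact hmR (by simp only [hR, mem_filter, mem_range]; exact ⟨hm, a, ha⟩)
    have hUnew : Unref (pre ++ [g]) pre.length := by
      intro j g' a hj ha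
      have hj' := (List.getElem?_eq_some_iff.1 hj).1
      simp only [List.length_append, List.length_singleton] at hj'
      by_cases hjp : j < pre.length
      · rw [List.getElem?_append_left hjp] at hj
        have := hwf' j g' hj a _ ha; omega
      · obtain rfl : j = pre.length := by omega
        rw [hget, Option.some.injEq] at hj; subst hj
        have := hOK a _ ha; omega
    -- `R` consists of reference-free gates of `pre`
    have hRsub : R ⊆ (range pre.length).filter (Unref pre) := by
      intro m hm
      simp only [hR, mem_filter, mem_range] at hm ⊢
      obtain ⟨hm, a, ha⟩ := hm
      refine ⟨hm, fun j g' a' hj ha' => ?_⟩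
      have hj' : j < pre.length := (List.getElem?_eq_some_iff.1 hj).1
      have := hF1 j pre.length g' g a' a m (by rwa [List.getElem?_append_left hj']) hget ha' ha
      omega
    -- split the new sum
    have hsplit : (range (pre ++ [g]).length).filter (Unref (pre ++ [g])) =
        insert pre.length (((range pre.length).filter (Unref pre)) \ R) := by
      ext m
      simp only [List.length_append, List.length_singleton, mem_filter, mem_range, mem_insert,
        mem_sdiff]
      constructor
      · rintro ⟨hm, hu⟩
        by_cases hmp : m = pre.length
        · exact Or.inl hmp
        · have hm' : m < pre.length := by omega
          exact Or.inr ⟨⟨hm', ((hU m hm').1 hu).1⟩, ((hU m hm').1 hu).2⟩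
      · rintro (rfl | ⟨⟨hm, hu⟩, hmR⟩)
        · exact ⟨by omega, hUnew⟩
        · exact ⟨by omega, (hU m hm).2 ⟨hu, hmR⟩⟩
    have hnot : pre.length ∉ ((range pre.length).filter (Unref pre)) \ R := by simp
    rw [hsplit, sum_insert hnot]
    -- old trees are unchanged
    have hold : ∀ m ∈ ((range pre.length).filter (Unref pre)) \ R,
        ((trees (pre ++ [g])).getD m (AndOrTree.const false)).leaves - 1 = L m - 1 := by
      intro m hm
      simp only [mem_sdiff, mem_filter, mem_range] at hm
      rw [getD_trees_append_of_lt pre [g] hm.1.1]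
    rw [sum_congr rfl hold, getD_trees_append_singleton]
    have hsd := sum_sdiff (f := fun m => L m - 1) hRsub
    have IH' : ∑ m ∈ (range pre.length).filter (Unref pre), (L m - 1) ≤ pre.length := IH
    -- the new gate
    obtain ⟨o, har, hshape, -⟩ := gateTree_shape (trees pre) hgB
    rw [hshape, AndOrTree.leaves_node]
    -- leaves of an argument wire
    have hLw : ∀ a : Fin g.arity, (wireTree (trees pre) (g.args a)).leaves =
        match g.args a with | .inl _ => 1 | .inr m => L m := by
      intro a; cases g.args a <;> rfl
    rw [hLw, hLw]
    set a0 : Fin g.arity := Fin.cast har.symm 0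
    set a1 : Fin g.arity := Fin.cast har.symm 1
    have ha01 : a0 ≠ a1 := by
      intro h; have := congrArg Fin.val h; simp [a0, a1] at this
    -- it suffices to bound the new term by the removed terms plus one
    suffices hkey : (match g.args a0 with | .inl _ => 1 | .inr m => L m) +
        (match g.args a1 with | .inl _ => 1 | .inr m => L m) - 1 ≤ (∑ m ∈ R, (L m - 1)) + 1 by
      simp only [List.length_append, List.length_singleton]
      omega
    have hmemR : ∀ a m, g.args a = .inr m → m ∈ R := fun a m ha => by
      simp only [hR, mem_filter, mem_range]; exact ⟨hOK a m ha, a, ha⟩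
    cases h0 : g.args a0 with
    | inl i =>
      cases h1 : g.args a1 with
      | inl i' => simp
      | inr m1 =>
        have := single_le_sum (f := fun m => L m - 1) (fun _ _ => Nat.zero_le _) (hmemR a1 m1 h1)
        simp only at this ⊢; omega
    | inr m0 =>
      cases h1 : g.args a1 with
      | inl i' =>
        have := single_le_sum (f := fun m => L m - 1) (fun _ _ => Nat.zero_le _) (hmemR a0 m0 h0)
        simp only at this ⊢; omega
      | inr m1 =>
        have hne : m0 ≠ m1 := by
          intro h; subst h; exact ha01 (hSI pre.length g a0 a1 m0 hget h0 h1)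
        have hsub : ({m0, m1} : Finset ℕ) ⊆ R := by
          intro m hm; simp only [mem_insert, mem_singleton] at hm
          rcases hm with rfl | rfl
          · exact hmemR a0 _ h0
          · exact hmemR a1 _ h1
        have := sum_le_sum_of_subset (f := fun m => L m - 1) hsub
        rw [sum_pair hne] at this
        simp only at this ⊢; omega

end GateList

namespace Circuit

variable {ι : Type u}

open Classical in
/-- **A monotone straight-line formula unfolds into a constant-free `∧/∨` tree with at most
`size + 1` leaves computing the same function.** [cite: Jukna2012, §6.1] -/
theorem exists_tree_of_formula (C : Circuit ι) (hO : C.IsOver monotoneBasis) (hF : C.IsFormula) :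
    ∃ t : AndOrTree ι, t.NoConst ∧ (∀ x, t.eval x = C.eval x) ∧ t.leaves ≤ C.size + 1 := by
  cases hout : C.output with
  | inl i =>
    refine ⟨AndOrTree.leaf i, trivial, fun x => ?_, by simp⟩
    rw [circuit_eval, hout]; rfl
  | inr m₀ =>
    have hm₀ : m₀ < C.gates.length := C.wf_output m₀ hout
    set pre := C.gates.take (m₀ + 1) with hpre
    have hsplit : C.gates = pre ++ C.gates.drop (m₀ + 1) := (List.take_append_drop _ _).symm
    have hlen : pre.length = m₀ + 1 := by simp [hpre]; omega
    have hwf : WF pre := by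
      have h := wf_gates C; rw [hsplit] at h; exact h.of_append_left
    have hB : ∀ g ∈ pre, g.fn ∈ monotoneBasis := fun g hg => hO g (List.mem_of_mem_take hg)
    have hF1 : GateList.FanOutOne pre := by
      have h := hF.fanOutOne; rw [hsplit] at h; exact h.of_append_left
    have hSI : GateList.SlotInj pre := by
      have h := hF.slotInj; rw [hsplit] at h; exact h.of_append_left
    have hspec := GateList.trees_spec pre hwf hB m₀ (by omega)
    refine ⟨(GateList.trees pre).getD m₀ (AndOrTree.const false), hspec.2, fun x => ?_, ?_⟩
    · rw [hspec.1 x, circuit_eval, hout, hsplit, wireOf_vals_append _ _ _ _ (fun m hm => by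
        cases hm; omega), wireOf_inr]
    · have hpot := GateList.leaves_potential pre hwf hB hF1 hSI
      have hmem : m₀ ∈ (range pre.length).filter (GateList.Unref pre) := by
        simp only [mem_filter, mem_range]
        refine ⟨by omega, fun j g a hj ha => ?_⟩
        have hj := (List.getElem?_eq_some_iff.1 hj).1
        have := hwf j g (by assumption) a m₀ ha
        omega
      have := single_le_sum (f := fun m => ((GateList.trees pre).getD m (AndOrTree.const false)).leaves - 1)
        (fun _ _ => Nat.zero_le _) hmem
      have hsz : m₀ + 1 ≤ C.size := hm₀
      omega

end Circuit

/-! ## The discharge -/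

/-- **Formula Balancing Lemma, monotone form (Spira 1971; Jukna 2012, Lemma 6.1)** — discharge of
the named fact `monotoneFormula_balancing` with the constant `c = 6`: every monotone straight-line
formula `F` is equivalent to a monotone formula of depth at most `6 · log₂ (F.size + 1)`.
[cite: Jukna2012, Lemma 6.1 and §6.1 (pp. 159–160)] -/
theorem monotoneFormula_balancing_holds : monotoneFormula_balancing := by
  refine ⟨6, by norm_num, fun ι F hO hF => ?_⟩
  obtain ⟨t, htc, hte, htl⟩ := Circuit.exists_tree_of_formula F hO hF
  obtain ⟨t', ht'e, ht'd⟩ := AndOrTree.exists_balanced (F.size + 1) t htl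
  set u := AndOrTree.clean t' with hu
  have hue : ∀ x, u.eval x = F.eval x := fun x => by rw [hu, AndOrTree.eval_clean, ht'e, hte]
  have hud : u.depth ≤ 2 * AndOrTree.spiraSteps (F.size + 1) := (AndOrTree.depth_clean_le t').trans ht'd
  rcases AndOrTree.clean_clean t' with hnc | ⟨b, hb⟩
  · refine ⟨u.toCircuit, AndOrTree.isOver_toCircuit hnc, (AndOrTree.isFormula_toCircuit hnc).1,
      fun x => by rw [AndOrTree.eval_toCircuit hnc, hue], ?_⟩
    rw [AndOrTree.depth_toCircuit hnc]
    -- `depth ≤ 2 s(m) ≤ 6 ⌊log₂ m⌋ ≤ 6 log₂ m`, `m = size + 1`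
    have hs := AndOrTree.spiraSteps_le (F.size + 1)
    have h6 : 2 * AndOrTree.spiraSteps (F.size + 1) ≤ 6 * Nat.log 2 (F.size + 1) := by
      by_cases h1 : F.size + 1 ≤ 1
      · rw [AndOrTree.spiraSteps_of_le_one h1]; exact Nat.zero_le _
      · have hL : 1 ≤ Nat.log 2 (F.size + 1) := Nat.log_pos (by norm_num) (by omega)
        omega
    have hlog : ((Nat.log 2 (F.size + 1) : ℕ) : ℝ) ≤ Real.logb 2 (F.size + 1) := by
      have := Real.natLog_le_logb (F.size + 1) 2
      push_cast at this
      exact this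
    calc (u.depth : ℝ) ≤ ((6 * Nat.log 2 (F.size + 1) : ℕ) : ℝ) := by
          exact_mod_cast hud.trans h6
      _ = 6 * ((Nat.log 2 (F.size + 1) : ℕ) : ℝ) := by push_cast; ring
      _ ≤ 6 * Real.logb 2 (F.size + 1) := by gcongr
  · -- a constant outcome is impossible for a constant-free monotone tree
    exfalso
    have h0 := hue (fun _ => false)
    have h1 := hue (fun _ => true)
    rw [← hu] at hb
    rw [hb, AndOrTree.eval_const, ← hte, AndOrTree.eval_false_of_noConst htc] at h0
    rw [hb, AndOrTree.eval_const, ← hte, AndOrTree.eval_true_of_noConst htc] at h1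
    rw [h0] at h1
    exact Bool.false_ne_true h1

/-! ## Discharge of `RazWigderson1992_bpm_monotoneFormulaSize` -/

namespace KWTree

variable {ι : Type u}

/-- **The scan protocol** for the monotone Karchmer–Wigderson game: run through a list of
coordinates; at `i` Alice announces `a i` and, if it is `1`, Bob announces `b i`; stop at the first
`i` with `a i = 1`, `b i = 0` (default leaf `i₀` if the list is exhausted).
[cite: KarchmerWigderson1990, §2 (the monotone relation R_f^m)] -/
def scanTree (i₀ : ι) : List ι → KWTree ι
  | [] => leaf i₀
  | i :: l => alice (fun a => a i) (scanTree i₀ l) (bob (fun b => b i) (leaf i) (scanTree i₀ l))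

/-- The scan protocol finds a coordinate with `a i = 1`, `b i = 0` whenever the list contains one.
[cite: KarchmerWigderson1990, §2] -/
theorem run_scanTree_spec (i₀ : ι) (a b : ι → Bool) :
    ∀ l : List ι, (∃ i ∈ l, a i = true ∧ b i = false) →
      a ((scanTree i₀ l).run a b) = true ∧ b ((scanTree i₀ l).run a b) = false
  | [], h => by simp at h
  | i :: l, h => by
      obtain ⟨j, hj, haj, hbj⟩ := h
      simp only [scanTree, run_alice, run_bob, run_leaf]
      cases hai : a i
      · simp only [Bool.false_eq_true, ↓reduceIte]
        refine run_scanTree_spec i₀ a b l ⟨j, ?_, haj, hbj⟩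
        rcases List.mem_cons.1 hj with rfl | hj'
        · rw [hai] at haj; exact absurd haj Bool.false_ne_true
        · exact hj'
      · simp only [↓reduceIte]
        cases hbi : b i
        · simp only [Bool.false_eq_true, ↓reduceIte]
          exact ⟨hai, hbi⟩
        · simp only [↓reduceIte]
          refine run_scanTree_spec i₀ a b l ⟨j, ?_, haj, hbj⟩
          rcases List.mem_cons.1 hj with rfl | hj'
          · rw [hbi] at hbj; exact absurd hbj (by decide)
          · exact hj'

/-- For a monotone `h` on a finite coordinate set the scan protocol over all coordinates solves the
monotone Karchmer–Wigderson game of `h` (if `h a = 1`, `h b = 0` then `a ≰ b`, i.e. some `i` has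
`a i = 1`, `b i = 0`). [cite: KarchmerWigderson1990, §2 (R_f^m is total for monotone f)] -/
theorem scanTree_solvesMono [Fintype ι] (i₀ : ι) (h : (ι → Bool) → Bool) (hmono : Monotone h) :
    (scanTree i₀ Finset.univ.toList).SolvesMono h := by
  intro a b ha hb
  refine run_scanTree_spec i₀ a b _ ?_
  by_contra hne
  have hab : a ≤ b := fun i => by
    cases hai : a i
    · exact Bool.false_le _
    · cases hbi : b i
      · exact absurd ⟨i, Finset.mem_toList.2 (Finset.mem_univ i), hai, hbi⟩ hne
      · exact le_rfl
  have := hmono hab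
  rw [ha, hb] at this
  exact absurd this (by decide)

end KWTree

/-- **Raz–Wigderson: monotone formulas for bipartite perfect matching have size `2^{Ω(n)}` —
PROVED**: discharge of `RazWigderson1992_bpm_monotoneFormulaSize`, exactly as announced in its
docstring: a smallest monotone formula `F` for `f_m` (one exists: the scan protocol turned into a
formula, `KWTree.exists_formula_of_solvesMono`) is balanced (`monotoneFormula_balancing_holds`,
depth `≤ c_b log₂(|F|+1)`), and the balanced formula is a monotone circuit, so it has depth
`≥ c_d · m` (`RazWigderson1992_bpm_monotoneDepth_holds`); hence `|F| + 1 ≥ 2^{c_d m / c_b}` and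
`|F| ≥ 2^{c m}` with `c = c_d / (2 c_b)` for `m ≥ max(n₀, 1, ⌈2 c_b / c_d⌉)`.
[cite: CavalarEtAl2026, §1.2] [cite: RazWigderson1992, Thm. 4.2] [cite: Jukna2012, Lemma 6.1 and Cor. 7.27] -/
theorem RazWigderson1992_bpm_monotoneFormulaSize_holds : RazWigderson1992_bpm_monotoneFormulaSize := by
  classical
  open Literature.Barriers.PneNP in
  obtain ⟨cd, hcd, n₀, Hd⟩ := RazWigderson1992_bpm_monotoneDepth_holds
  obtain ⟨cb, hcb, Hb⟩ := monotoneFormula_balancing_holds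
  refine ⟨cd / (2 * cb), by positivity, max n₀ (max 1 ⌈2 * cb / cd⌉₊), fun m hm => ?_⟩
  have hmn₀ : n₀ ≤ m := le_trans (le_max_left _ _) hm
  have hm1 : 1 ≤ m := le_trans (le_trans (le_max_left _ _) (le_max_right _ _)) hm
  have hmM : ⌈2 * cb / cd⌉₊ ≤ m := le_trans (le_trans (le_max_right _ _) (le_max_right _ _)) hm
  -- a monotone formula for `f_m` exists, so `formulaSizeOver` is attained
  set S : Set ℕ := {s | ∃ C : Circuit (Fin m × Fin m), C.IsOver monotoneBasis ∧ C.IsFormula ∧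
    C.Computes (perfectMatchingFn m) ∧ C.size = s} with hS
  have h1 : perfectMatchingFn m (fun _ => true) = true :=
    (perfectMatchingFn_eq_true_iff m _).2 ⟨Equiv.refl _, fun _ => rfl⟩
  have h0 : perfectMatchingFn m (fun _ => false) = false := by
    rw [Bool.eq_false_iff]
    intro h
    obtain ⟨σ, hσ⟩ := (perfectMatchingFn_eq_true_iff m _).1 h
    exact Bool.false_ne_true (hσ ⟨0, hm1⟩)
  have hne : S.Nonempty := by
    obtain ⟨C, hO, hF, hC, -⟩ := (KWTree.scanTree ((⟨0, hm1⟩ : Fin m), (⟨0, hm1⟩ : Fin m))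
      Finset.univ.toList).exists_formula_of_solvesMono
      (KWTree.scanTree_solvesMono _ _ (perfectMatchingFn_monotone m)) ⟨_, h1⟩ ⟨_, h0⟩
    exact ⟨C.size, C, hO, hF, hC, rfl⟩
  have hmem : formulaSizeOver monotoneBasis (perfectMatchingFn m) ∈ S := by
    unfold formulaSizeOver
    exact Nat.sInf_mem hne
  obtain ⟨F, hO, hF, hC, hsize⟩ := hmem
  -- balance it and apply the depth bound
  obtain ⟨F', hO', hF', heval, hdepth⟩ := Hb (Fin m × Fin m) F hO hF
  have hC' : F'.Computes (perfectMatchingFn m) := fun x => (heval x).trans (hC x)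
  have hd := Hd m hmn₀ F' hO' hC'
  have hlog : cd * m / cb ≤ Real.logb 2 (F.size + 1) := by
    rw [div_le_iff₀ hcb]
    linarith [mul_comm cb (Real.logb 2 (F.size + 1))]
  have hpow : (2 : ℝ) ^ (cd * m / cb) ≤ F.size + 1 := by
    have := Real.rpow_le_rpow_of_exponent_le one_le_two hlog
    rwa [Real.rpow_logb two_pos (by norm_num) (by positivity)] at this
  set A : ℝ := (2 : ℝ) ^ (cd / (2 * cb) * m) with hA
  have hA2 : A * A = (2 : ℝ) ^ (cd * m / cb) := by
    rw [hA, ← Real.rpow_add two_pos]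
    congr 1
    field_simp
    ring
  have hcm : 1 ≤ cd / (2 * cb) * m := by
    have h := Nat.le_ceil (2 * cb / cd)
    have h' : (⌈2 * cb / cd⌉₊ : ℝ) ≤ m := by exact_mod_cast hmM
    have h'' : 2 * cb / cd ≤ m := le_trans h h'
    rw [div_le_iff₀ hcd] at h''
    rw [div_mul_eq_mul_div, le_div_iff₀ (by positivity)]
    linarith
  have hA1 : 2 ≤ A := by
    have := Real.rpow_le_rpow_of_exponent_le one_le_two hcm
    rwa [Real.rpow_one] at this
  have hsz : (F.size : ℝ) = formulaSizeOver monotoneBasis (perfectMatchingFn m) := by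
    rw [hsize]
  rw [← hsz]
  nlinarith [hA2, hpow, hA1]

end Literature.Computability.Complexity
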